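import Mathlib
import Literature.MathematicalPhysics.StatisticalMechanics.Crystallization
import Literature.MathematicalPhysics.StatisticalMechanics.LennardJonesClusters
import Literature.MathematicalPhysics.StatisticalMechanics.SeparatedShellSums
import Literature.MathematicalPhysics.StatisticalMechanics.LocalMatchingCompactness
import Summits.AtomisticToContinuum.Crystallization.Theorems.BraggSlacknessRigiditySlacknessTransferFourier
import Summits.AtomisticToContinuum.Crystallization.Theorems.BraggSlacknessRigidityHcpDiffractionRigidityDenseCentresAux
import Summits.AtomisticToContinuum.Crystallization.Theorems.BraggSlacknessRigidityHcpDiffractionRigidityDenseCentresAux2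
import Summits.AtomisticToContinuum.Crystallization.Theorems.BraggSlacknessRigidityHcpDiffractionRigidityDenseCentres
import Summits.AtomisticToContinuum.Crystallization.Theorems.BraggSlacknessRigidityHcpDiffractionRigidityQuietCentresAux
import Summits.AtomisticToContinuum.Crystallization.Theorems.BraggSlacknessRigidityHcpDiffractionRigidityQuietCentresAux2

/-!
# Quiet centres (stub `stub_quietCentres` of crux `HcpDiffractionRigidity`,
# item `stmt-AtomisticToContinuum-13166`, line `registered`)

**Markov form of the windowed `S3` transfer.** For a hard-core sequence of `N`-point
configurations `x^N` in `ℝ³` whose structure factor `|S_N|²` carries `o(N)` mass on every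
admissible test function (continuous, compact support off `0` and off the Bragg spheres of a
periodic template `P`), for every admissible `h` and all `ε, θ > 0` there is `L₁` such that for
every scale `L ≥ L₁`, eventually in `N`, at most `εN` particles `i` have Gaussian mass
`MG_i = ∑ⱼ e^{-2|xⱼ-xᵢ|²/L²} ≥ θL³` and windowed intensity
`IG_i(h) = ∫ h |∑ⱼ e^{-|xⱼ-xᵢ|²/L²} e^{2πi⟨ξ,xⱼ-xᵢ⟩}|² > ε MG_i`.

Proof.  Replace `h` by `h⁺ = max(h, 0)` (admissible, `IG_i(h) ≤ IG_i(h⁺)`, `IG_i(h⁺) ≥ 0`).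
By the operator inequality `M² ≤ ‖M‖M` for the Gaussian matrix (Aux file 1),
`∑ᵢ IG_i(h⁺) ≤ Λ ∫ h⁺ Re Q`, `Λ = C_δ L³`, `Q` the Gaussian pair sum, and by the convolution
identity (Aux file 2) `∫ h⁺ Re Q = ∫ g |S_N|²` with `g = h⁺ ∗ 𝓕⁻¹G_L`.  Split `g = fg + (1-f)g`
with a cutoff `f = 1` near `tsupport h⁺`: `fg` is admissible (the support of `h` keeps a uniform
gap `d` from `0` and the Bragg spheres, `exists_gap`), so `∫ fg|S_N|² = o(N)` by `S3`, while
`|(1-f)g| ≤ 4‖h‖_∞ e^{4πR²} e^{-π²L²d²/8} e^{-π|ξ|²}` and Gaussian almost orthogonality give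
`O(e^{-cL²} N)`.  Markov: `#bad · εθL³ ≤ ∑ᵢ IG_i(h⁺) ≤ C_δ L³ (o(N) + O(e^{-cL²}) N)`.
All `[folklore]`.
-/

noncomputable section

namespace Summit.AtomisticToContinuum.Crystallization.Theorems

open MeasureTheory Metric Filter Complex Set
open scoped BigOperators Classical Real RealInnerProductSpace ComplexConjugate Convolution
open Literature.MathematicalPhysics.StatisticalMechanics
open Summit.AtomisticToContinuum.Crystallization.Theorems.BraggSlacknessTransfer
open Summit.AtomisticToContinuum.Crystallization.Theorems.HcpRigidityDenseCentres

namespace HcpRigidityQuietCentres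

/-! ## The fixed-`N` estimate -/

/-- **Fixed-`N` estimate.** For a `δ`-separated configuration `y`, `L ≥ 2`, a nonnegative
continuous compactly supported `h` with `|h| ≤ M`, `tsupport h ⊆ B(0,R)`, `0 < d ≤ 2R`, and a
cutoff `f ∈ [0,1]` with `f = 1` at the points within `d/2` of `tsupport h`:
`∑ᵢ IG_i(h) ≤ C_δ L³ (∫ f g |S_N|² + 4M e^{4πR²} e^{-π²L²d²/8} · 2(2/δ+1)³ N)`,
`g = c_L⁻¹ Re (h ⋆ γ_L)` the smoothed test function of Aux file 2, `C_δ = 2(2/δ+1)³π√π`.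
[folklore] -/
theorem sum_IG_le {N : ℕ} (y : Fin N → EuclideanSpace ℝ (Fin 3)) {δ : ℝ} (hδ : 0 < δ)
    (hsep : ∀ i j : Fin N, i ≠ j → δ ≤ dist (y i) (y j)) {L : ℝ} (hL : 2 ≤ L)
    {h : EuclideanSpace ℝ (Fin 3) → ℝ} (hhc : Continuous h) (hhs : HasCompactSupport h) (hh0 : ∀ ξ, 0 ≤ h ξ)
    {M R d : ℝ} (hM : ∀ t, |h t| ≤ M) (hR : tsupport h ⊆ closedBall (0 : EuclideanSpace ℝ (Fin 3)) R) (hd : 0 < d)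
    (hdR : d ≤ 2 * R) {f : EuclideanSpace ℝ (Fin 3) → ℝ} (hfc : Continuous f) (hf01 : ∀ ξ, 0 ≤ f ξ ∧ f ξ ≤ 1)
    (hfar : ∀ ζ, f ζ ≠ 1 → ∀ t ∈ tsupport h, d / 2 ≤ ‖ζ - t‖) :
    ∑ i, ∫ ξ : EuclideanSpace ℝ (Fin 3), h ξ * ‖∑ j, (Real.exp (-(‖y j - y i‖ ^ 2) / L ^ 2) : ℂ) *
        cexp (2 * Real.pi * I * (⟪ξ, y j - y i⟫ : ℂ))‖ ^ 2 ≤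
      (2 * (2 / δ + 1) ^ 3 * (Real.pi * Real.sqrt Real.pi) * L ^ 3) *
        ((∫ ζ : EuclideanSpace ℝ (Fin 3), (f ζ * (((Real.pi / (Real.pi ^ 2 * L ^ 2)) ^ ((3 : ℝ) / 2))⁻¹ *
        (((fun t => (h t : ℂ)) ⋆[ContinuousLinearMap.mul ℂ ℂ, volume] (fun v : EuclideanSpace ℝ (Fin 3) => ((Real.exp (-(Real.pi ^ 2 * L ^ 2) * ‖v‖ ^ 2) : ℝ) : ℂ))) ζ).re)) *
            ‖∑ j, cexp (2 * Real.pi * I * (⟪ζ, y j⟫ : ℂ))‖ ^ 2) +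
          4 * M * Real.exp (4 * Real.pi * R ^ 2) * Real.exp (-(Real.pi ^ 2 * L ^ 2 * d ^ 2 / 8)) *
            (2 * (2 / δ + 1) ^ 3 * N)) := by
  have hL1 : 1 ≤ L := by linarith
  have hL0 : 0 < L := by linarith
  have hM0 : 0 ≤ M := (abs_nonneg _).trans (hM 0)
  set Λ : ℝ := 2 * (2 / δ + 1) ^ 3 * (Real.pi * Real.sqrt Real.pi) * L ^ 3 with hΛ
  have hΛ0 : 0 < Λ := by positivity
  set sf : EuclideanSpace ℝ (Fin 3) → ℝ := fun ζ => ‖∑ j, cexp (2 * Real.pi * I * (⟪ζ, y j⟫ : ℂ))‖ ^ 2 with hsf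
  set sm : EuclideanSpace ℝ (Fin 3) → ℝ := fun ζ => (((Real.pi / (Real.pi ^ 2 * L ^ 2)) ^ ((3 : ℝ) / 2))⁻¹ *
        (((fun t => (h t : ℂ)) ⋆[ContinuousLinearMap.mul ℂ ℂ, volume] (fun v : EuclideanSpace ℝ (Fin 3) => ((Real.exp (-(Real.pi ^ 2 * L ^ 2) * ‖v‖ ^ 2) : ℝ) : ℂ))) ζ).re) with hsm
  set Q : EuclideanSpace ℝ (Fin 3) → ℂ := fun ξ => ∑ j, ∑ k, (Real.exp (-(‖y k - y j‖ ^ 2) / L ^ 2) : ℂ) *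
    cexp (2 * Real.pi * I * (⟪ξ, y j⟫ : ℂ)) * conj (cexp (2 * Real.pi * I * (⟪ξ, y k⟫ : ℂ))) with hQ
  set T : Fin N → EuclideanSpace ℝ (Fin 3) → ℝ := fun i ξ => ‖∑ j, (Real.exp (-(‖y j - y i‖ ^ 2) / L ^ 2) : ℂ) *
    cexp (2 * Real.pi * I * (⟪ξ, y j - y i⟫ : ℂ))‖ ^ 2 with hT
  have hTc : ∀ i, Continuous (T i) := fun i => by simp only [hT]; fun_prop
  have hQc : Continuous Q := by simp only [hQ]; fun_prop
  -- (i) sum through the integral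
  have hIi : ∀ i, Integrable fun ξ : EuclideanSpace ℝ (Fin 3) => h ξ * T i ξ := fun i =>
    (hhc.mul (hTc i)).integrable_of_hasCompactSupport hhs.mul_right
  have h1 : ∑ i, ∫ ξ : EuclideanSpace ℝ (Fin 3), h ξ * T i ξ = ∫ ξ : EuclideanSpace ℝ (Fin 3), h ξ * ∑ i, T i ξ := by
    rw [← integral_finsetSum _ fun i _ => hIi i]
    refine integral_congr_ae (ae_of_all _ fun ξ => ?_)
    simp only [Finset.mul_sum]
  -- (ii) the operator inequality, pointwise
  have hI2 : Integrable fun ξ : EuclideanSpace ℝ (Fin 3) => h ξ * (Λ * (Q ξ).re) :=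
    (hhc.mul (continuous_const.mul (Complex.continuous_re.comp hQc))).integrable_of_hasCompactSupport
      hhs.mul_right
  have h2 : ∫ ξ : EuclideanSpace ℝ (Fin 3), h ξ * ∑ i, T i ξ ≤ ∫ ξ : EuclideanSpace ℝ (Fin 3), h ξ * (Λ * (Q ξ).re) := by
    refine integral_mono ?_ hI2 fun ξ => ?_
    · have := integrable_finsetSum Finset.univ fun i _ => hIi i
      refine this.congr (ae_of_all _ fun ξ => ?_)
      simp only [Finset.mul_sum]
    · exact mul_le_mul_of_nonneg_left (sum_normSq_window_le y hδ hsep hL1 ξ) (hh0 ξ)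
  -- (iii) the convolution identity
  have h3 : ∫ ξ : EuclideanSpace ℝ (Fin 3), h ξ * (Λ * (Q ξ).re) = Λ * ∫ ζ : EuclideanSpace ℝ (Fin 3), sm ζ * sf ζ := by
    have e : ∫ ξ : EuclideanSpace ℝ (Fin 3), h ξ * (Q ξ).re = ∫ ζ : EuclideanSpace ℝ (Fin 3), sm ζ * sf ζ :=
      integral_mul_re_pairSum_eq y hL0 hhc hhs
    rw [← e, ← integral_const_mul]
    refine integral_congr_ae (ae_of_all _ fun ξ => ?_)
    ring
  -- (iv) split with the cutoff
  have hIs : Integrable fun ζ : EuclideanSpace ℝ (Fin 3) => sm ζ * sf ζ := integrable_smooth_mul_sf hL0 hhc hhs y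
  have hIf : Integrable fun ζ : EuclideanSpace ℝ (Fin 3) => (f ζ * sm ζ) * sf ζ := by
    have := hIs.bdd_mul (c := 1) hfc.aestronglyMeasurable (ae_of_all _ fun ζ => by
      rw [Real.norm_eq_abs, abs_of_nonneg (hf01 ζ).1]; exact (hf01 ζ).2)
    refine this.congr (ae_of_all _ fun ζ => ?_)
    simp only [hsf]
    ring
  have hI1f : Integrable fun ζ : EuclideanSpace ℝ (Fin 3) => ((1 - f ζ) * sm ζ) * sf ζ := by
    have h1c : Continuous fun ζ : EuclideanSpace ℝ (Fin 3) => 1 - f ζ := continuous_const.sub hfc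
    have := hIs.bdd_mul (c := 1) h1c.aestronglyMeasurable
      (ae_of_all _ fun ζ => by
        rw [Real.norm_eq_abs, abs_of_nonneg (by linarith [(hf01 ζ).2])]; linarith [(hf01 ζ).1])
    refine this.congr (ae_of_all _ fun ζ => ?_)
    simp only [hsf]
    ring
  have h4 : ∫ ζ : EuclideanSpace ℝ (Fin 3), sm ζ * sf ζ =
      (∫ ζ : EuclideanSpace ℝ (Fin 3), (f ζ * sm ζ) * sf ζ) + ∫ ζ : EuclideanSpace ℝ (Fin 3), ((1 - f ζ) * sm ζ) * sf ζ := by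
    rw [← integral_add hIf hI1f]
    refine integral_congr_ae (ae_of_all _ fun ζ => ?_)
    ring
  -- (v) the tail
  set τ : ℝ := 4 * M * Real.exp (4 * Real.pi * R ^ 2) * Real.exp (-(Real.pi ^ 2 * L ^ 2 * d ^ 2 / 8))
    with hτ
  have hτ0 : 0 ≤ τ := by positivity
  have hIg : Integrable fun ζ : EuclideanSpace ℝ (Fin 3) => τ * (Real.exp (-Real.pi * ‖ζ‖ ^ 2) * sf ζ) := by
    refine Integrable.const_mul ?_ _
    exact (integrable_rexp_neg_mul_sq_norm Real.pi_pos).mul_bdd (c := (N : ℝ) ^ 2)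
      (continuous_sf y).aestronglyMeasurable (ae_of_all _ fun ζ => by
        rw [Real.norm_eq_abs, abs_of_nonneg (by positivity)]; exact sf_le y ζ)
  have h5 : ∫ ζ : EuclideanSpace ℝ (Fin 3), ((1 - f ζ) * sm ζ) * sf ζ ≤ τ * (2 * (2 / δ + 1) ^ 3 * N) := by
    have hpt : ∀ ζ : EuclideanSpace ℝ (Fin 3), ((1 - f ζ) * sm ζ) * sf ζ ≤
        τ * (Real.exp (-Real.pi * ‖ζ‖ ^ 2) * sf ζ) := by
      intro ζ
      have hsf0 : 0 ≤ sf ζ := by positivity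
      by_cases hfζ : f ζ = 1
      · rw [hfζ, sub_self, zero_mul, zero_mul]; positivity
      · have hb : |sm ζ| ≤ 4 * M * Real.exp (4 * Real.pi * R ^ 2) *
            Real.exp (-(Real.pi ^ 2 * L ^ 2 * d ^ 2 / 8)) * Real.exp (-Real.pi * ‖ζ‖ ^ 2) :=
          abs_smooth_le hL hM hR hd hdR ζ (hfar ζ hfζ)
        have h1f : |1 - f ζ| ≤ 1 := by
          rw [abs_of_nonneg (by linarith [(hf01 ζ).2])]; linarith [(hf01 ζ).1]
        have : (1 - f ζ) * sm ζ ≤ τ * Real.exp (-Real.pi * ‖ζ‖ ^ 2) := by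
          calc (1 - f ζ) * sm ζ ≤ |(1 - f ζ) * sm ζ| := le_abs_self _
            _ = |1 - f ζ| * |sm ζ| := abs_mul _ _
            _ ≤ 1 * (τ * Real.exp (-Real.pi * ‖ζ‖ ^ 2)) := by
                refine mul_le_mul h1f ?_ (abs_nonneg _) zero_le_one
                rw [hτ]; linarith
            _ = τ * Real.exp (-Real.pi * ‖ζ‖ ^ 2) := one_mul _
        calc ((1 - f ζ) * sm ζ) * sf ζ ≤ (τ * Real.exp (-Real.pi * ‖ζ‖ ^ 2)) * sf ζ :=
              mul_le_mul_of_nonneg_right this hsf0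
          _ = _ := by ring
    refine (integral_mono hI1f hIg hpt).trans ?_
    rw [integral_const_mul]
    refine mul_le_mul_of_nonneg_left ?_ hτ0
    have hao := integral_gauss_sf_le y hδ hsep (le_refl (1 : ℝ))
    simp only [one_pow, mul_one] at hao
    exact hao
  -- collect
  calc ∑ i, ∫ ξ : EuclideanSpace ℝ (Fin 3), h ξ * ‖∑ j, (Real.exp (-(‖y j - y i‖ ^ 2) / L ^ 2) : ℂ) *
        cexp (2 * Real.pi * I * (⟪ξ, y j - y i⟫ : ℂ))‖ ^ 2
      = ∫ ξ : EuclideanSpace ℝ (Fin 3), h ξ * ∑ i, T i ξ := h1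
    _ ≤ ∫ ξ : EuclideanSpace ℝ (Fin 3), h ξ * (Λ * (Q ξ).re) := h2
    _ = Λ * ((∫ ζ : EuclideanSpace ℝ (Fin 3), (f ζ * sm ζ) * sf ζ) +
          ∫ ζ : EuclideanSpace ℝ (Fin 3), ((1 - f ζ) * sm ζ) * sf ζ) := by rw [h3, h4]
    _ ≤ Λ * ((∫ ζ : EuclideanSpace ℝ (Fin 3), (f ζ * sm ζ) * sf ζ) + τ * (2 * (2 / δ + 1) ^ 3 * N)) := by
        gcongr
    _ = _ := by simp only [hsm, hsf, hτ]

end HcpRigidityQuietCentres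

open HcpRigidityQuietCentres

/-- **STUB A2 — quiet centres (Markov form of the windowed S3 transfer; Fourier).** For any
periodic template `P`, hard core `δ` and a sequence `x^N` satisfying S3: for every admissible test
function `h` (continuous, compact support off `0` and off the Bragg spheres of `P`) and all
`ε, θ > 0` there is `L₁` such that for every `L ≥ L₁`, eventually in `N`, at most `εN` particles
`i` are `θ`-dense at scale `L` (Gaussian mass `≥ θL³`) and yet have Gaussian-windowed intensity
`∫ h |Σ_j e^{-‖x_j-x_i‖²/L²} e^{2πi⟨ξ,x_j-x_i⟩}|² > ε ·` Gaussian mass. [folklore] -/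
theorem stub_quietCentres : ∀ (P : Literature.MathematicalPhysics.StatisticalMechanics.PeriodicConfiguration 3) (δ : ℝ), 0 < δ → ∀ x : (N : ℕ) → (Fin N → EuclideanSpace ℝ (Fin 3)), (∀ (N : ℕ) (i j : Fin N), i ≠ j → δ ≤ dist (x N i) (x N j)) → (∀ h : EuclideanSpace ℝ (Fin 3) → ℝ, Continuous h → HasCompactSupport h → (∀ ξ ∈ tsupport h, ξ ≠ 0 ∧ ∀ k : EuclideanSpace ℝ (Fin 3), (∀ g ∈ P.lattice, ∃ n : ℤ, inner ℝ k g = (n : ℝ)) → ‖ξ‖ ≠ ‖k‖) → Filter.Tendsto (fun N : ℕ => (∫ ξ, h ξ * ‖∑ j : Fin N, Complex.exp (2 * Real.pi * Complex.I * (inner ℝ ξ (x N j) : ℂ))‖ ^ 2) / N) Filter.atTop (nhds 0)) → ∀ h : EuclideanSpace ℝ (Fin 3) → ℝ, Continuous h → HasCompactSupport h → (∀ ξ ∈ tsupport h, ξ ≠ 0 ∧ ∀ k : EuclideanSpace ℝ (Fin 3), (∀ g ∈ P.lattice, ∃ n : ℤ, inner ℝ k g = (n : ℝ)) → ‖ξ‖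 ≠ ‖k‖) → ∀ ε θ : ℝ, 0 < ε → 0 < θ → ∃ L₁ : ℝ, ∀ L : ℝ, L₁ ≤ L → ∀ᶠ N : ℕ in Filter.atTop, ((Finset.univ.filter (fun i : Fin N => θ * L ^ 3 ≤ ∑ j : Fin N, Real.exp (-(‖x N j - x N i‖ ^ 2) / L ^ 2) ^ 2 ∧ ε * ∑ j : Fin N, Real.exp (-(‖x N j - x N i‖ ^ 2) / L ^ 2) ^ 2 < ∫ ξ, h ξ * ‖∑ j : Fin N, (Real.exp (-(‖x N j - x N i‖ ^ 2) / L ^ 2) : ℂ) * Complex.exp (2 * Real.pi * Complex.I * (inner ℝ ξ (x N j - x N i) : ℂ))‖ ^ 2)).card : ℝ) ≤ ε * N := by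
  intro P δ hδ x hsep hS3 h hhc hhs hadm ε θ hε hθ
  -- Step 0: the positive part of `h`
  set hp : EuclideanSpace ℝ (Fin 3) → ℝ := fun ξ => max (h ξ) 0 with hhp
  have hhpc : Continuous hp := hhc.max continuous_const
  have hsupp : Function.support hp ⊆ Function.support h := by
    intro ξ hξ
    simp only [Function.mem_support, ne_eq] at hξ ⊢
    intro h0
    apply hξ
    simp [hhp, h0]
  have hhps : HasCompactSupport hp := hhs.mono hsupp
  have htsupp : tsupport hp ⊆ tsupport h := closure_mono hsupp
  have hp0 : ∀ ξ, 0 ≤ hp ξ := fun ξ => le_max_right _ _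
  have hph : ∀ ξ, h ξ ≤ hp ξ := fun ξ => le_max_left _ _
  obtain ⟨M, hM⟩ : ∃ M : ℝ, ∀ t, |hp t| ≤ M := by
    obtain ⟨C, hC⟩ := hhpc.bounded_above_of_compact_support hhps
    exact ⟨C, fun t => by simpa only [Real.norm_eq_abs] using hC t⟩
  have hM0 : 0 ≤ M := (abs_nonneg _).trans (hM 0)
  -- Step 1: the gap and the radius of the support
  obtain ⟨d, hd, hgap⟩ := exists_gap P hhs hadm
  obtain ⟨R₀, hR₀⟩ := hhs.isCompact.isBounded.subset_closedBall (0 : EuclideanSpace ℝ (Fin 3))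
  set R : ℝ := max R₀ d with hRdef
  have hR : tsupport hp ⊆ closedBall (0 : EuclideanSpace ℝ (Fin 3)) R :=
    htsupp.trans (hR₀.trans (closedBall_subset_closedBall (le_max_left _ _)))
  have hdR : d ≤ 2 * R := by have := le_max_right R₀ d; linarith
  -- Step 2: the cutoff
  obtain ⟨f, hfc, hfs, hf01, hf1, hftsupp⟩ := exists_thickCutoff hhps.isCompact hd
  have hfar : ∀ ζ, f ζ ≠ 1 → ∀ t ∈ tsupport hp, d / 2 ≤ ‖ζ - t‖ := by
    intro ζ hζ t ht
    by_contra hlt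
    rw [not_le] at hlt
    exact hζ (hf1 ζ ⟨t, ht, by rw [dist_eq_norm]; exact hlt.le⟩)
  -- Step 3: constants and the choice of `L₁`
  set K : ℝ := 2 * (2 / δ + 1) ^ 3 with hK
  have hK0 : 0 < K := by positivity
  set CA : ℝ := K * (Real.pi * Real.sqrt Real.pi) with hCA
  have hCA0 : 0 < CA := by positivity
  set A : ℝ := CA / (ε * θ) * (4 * M * Real.exp (4 * Real.pi * R ^ 2) * K) with hA
  have hA0 : 0 ≤ A := by positivity
  have hlim : Tendsto (fun L : ℝ => A * Real.exp (-(Real.pi ^ 2 * L ^ 2 * d ^ 2 / 8))) atTop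
      (nhds 0) := by
    have h1 : Tendsto (fun L : ℝ => Real.pi ^ 2 * d ^ 2 / 8 * L ^ 2) atTop atTop :=
      Tendsto.const_mul_atTop (by positivity) (tendsto_pow_atTop two_ne_zero)
    have h2 := (Real.tendsto_exp_neg_atTop_nhds_zero.comp h1).const_mul A
    rw [mul_zero] at h2
    convert h2 using 2 with L
    simp only [Function.comp_apply]
    congr 2
    ring
  obtain ⟨L₁, hL₁⟩ := Filter.eventually_atTop.1
    ((hlim.eventually_lt_const (half_pos hε)).and (eventually_ge_atTop (2 : ℝ)))
  refine ⟨L₁, fun L hL => ?_⟩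
  obtain ⟨hτL, hL2⟩ := hL₁ L hL
  have hL0 : 0 < L := by linarith
  -- Step 4: `S3` for the admissible part `g₁ = f · smooth L h⁺`
  set g₁ : EuclideanSpace ℝ (Fin 3) → ℝ := fun ξ => f ξ * (((Real.pi / (Real.pi ^ 2 * L ^ 2)) ^ ((3 : ℝ) / 2))⁻¹ *
        (((fun t => (hp t : ℂ)) ⋆[ContinuousLinearMap.mul ℂ ℂ, volume] (fun v : EuclideanSpace ℝ (Fin 3) => ((Real.exp (-(Real.pi ^ 2 * L ^ 2) * ‖v‖ ^ 2) : ℝ) : ℂ))) ξ).re) with hg₁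
  have hg₁c : Continuous g₁ := hfc.mul (continuous_smooth L hhpc hhps)
  have hg₁s : HasCompactSupport g₁ := hfs.mul_right
  have hg₁adm : ∀ ξ ∈ tsupport g₁, ξ ≠ 0 ∧ ∀ k : EuclideanSpace ℝ (Fin 3),
      (∀ g ∈ P.lattice, ∃ n : ℤ, inner ℝ k g = (n : ℝ)) → ‖ξ‖ ≠ ‖k‖ := by
    intro ξ hξ
    obtain ⟨t, ht, hξt⟩ := hftsupp ξ (tsupport_mul_subset_left hξ)
    have ht' := htsupp ht
    have hnn : |‖ξ‖ - ‖t‖| ≤ 3 * d / 4 := (abs_norm_sub_norm_le ξ t).trans (by rwa [← dist_eq_norm])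
    refine ⟨fun h0 => ?_, fun k hk heq => ?_⟩
    · have hg0 := hgap t ht' 0 (fun g _ => ⟨0, by simp⟩)
      rw [norm_zero, sub_zero, abs_of_nonneg (norm_nonneg _)] at hg0
      rw [h0, norm_zero, zero_sub, abs_neg, abs_of_nonneg (norm_nonneg _)] at hnn
      linarith
    · have hgk := hgap t ht' k hk
      rw [heq] at hnn
      rw [abs_sub_comm] at hgk
      linarith
  have hev := (hS3 g₁ hg₁c hg₁s hg₁adm).eventually_lt_const
    (show (0 : ℝ) < ε * (ε * θ) / (2 * CA) by positivity)
  filter_upwards [hev, eventually_gt_atTop 0] with N hN hNpos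
  -- Step 5: fixed `N`
  have hNr : (0 : ℝ) < N := by exact_mod_cast hNpos
  have hint : ∫ ξ, g₁ ξ * ‖∑ j : Fin N, Complex.exp (2 * Real.pi * Complex.I *
      (inner ℝ ξ (x N j) : ℂ))‖ ^ 2 ≤ ε * (ε * θ) / (2 * CA) * N := by
    rw [div_lt_iff₀ hNr] at hN; exact hN.le
  have hkey := sum_IG_le (x N) hδ (hsep N) hL2 hhpc hhps hp0 hM hR hd hdR hfc hf01 hfar
  rw [← hK] at hkey
  -- the windowed intensities of `h` and `h⁺`
  have hIGc : ∀ (g : EuclideanSpace ℝ (Fin 3) → ℝ), Continuous g → HasCompactSupport g → ∀ i : Fin N,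
      Integrable fun ξ : EuclideanSpace ℝ (Fin 3) => g ξ * ‖∑ j : Fin N,
        (Real.exp (-(‖x N j - x N i‖ ^ 2) / L ^ 2) : ℂ) *
        Complex.exp (2 * Real.pi * Complex.I * (inner ℝ ξ (x N j - x N i) : ℂ))‖ ^ 2 := by
    intro g hgc hgs i
    refine (hgc.mul ?_).integrable_of_hasCompactSupport hgs.mul_right
    fun_prop
  have hIGle : ∀ i : Fin N, ∫ ξ, h ξ * ‖∑ j : Fin N, (Real.exp (-(‖x N j - x N i‖ ^ 2) / L ^ 2) : ℂ) *
      Complex.exp (2 * Real.pi * Complex.I * (inner ℝ ξ (x N j - x N i) : ℂ))‖ ^ 2 ≤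
      ∫ ξ, hp ξ * ‖∑ j : Fin N, (Real.exp (-(‖x N j - x N i‖ ^ 2) / L ^ 2) : ℂ) *
        Complex.exp (2 * Real.pi * Complex.I * (inner ℝ ξ (x N j - x N i) : ℂ))‖ ^ 2 :=
    fun i => integral_mono (hIGc h hhc hhs i) (hIGc hp hhpc hhps i) fun ξ =>
      mul_le_mul_of_nonneg_right (hph ξ) (by positivity)
  have hIG0 : ∀ i : Fin N, 0 ≤ ∫ ξ, hp ξ * ‖∑ j : Fin N, (Real.exp (-(‖x N j - x N i‖ ^ 2) / L ^ 2) : ℂ) *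
      Complex.exp (2 * Real.pi * Complex.I * (inner ℝ ξ (x N j - x N i) : ℂ))‖ ^ 2 :=
    fun i => integral_nonneg fun ξ => mul_nonneg (hp0 ξ) (by positivity)
  -- Markov
  set B := Finset.univ.filter (fun i : Fin N => θ * L ^ 3 ≤ ∑ j : Fin N,
    Real.exp (-(‖x N j - x N i‖ ^ 2) / L ^ 2) ^ 2 ∧ ε * ∑ j : Fin N,
    Real.exp (-(‖x N j - x N i‖ ^ 2) / L ^ 2) ^ 2 < ∫ ξ, h ξ * ‖∑ j : Fin N,
    (Real.exp (-(‖x N j - x N i‖ ^ 2) / L ^ 2) : ℂ) *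
    Complex.exp (2 * Real.pi * Complex.I * (inner ℝ ξ (x N j - x N i) : ℂ))‖ ^ 2) with hB
  have hcard : (B.card : ℝ) * (ε * θ * L ^ 3) ≤ ∑ i : Fin N, ∫ ξ, hp ξ * ‖∑ j : Fin N,
      (Real.exp (-(‖x N j - x N i‖ ^ 2) / L ^ 2) : ℂ) *
      Complex.exp (2 * Real.pi * Complex.I * (inner ℝ ξ (x N j - x N i) : ℂ))‖ ^ 2 := by
    calc (B.card : ℝ) * (ε * θ * L ^ 3) = ∑ i ∈ B, ε * θ * L ^ 3 := by
          rw [Finset.sum_const, nsmul_eq_mul]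
      _ ≤ ∑ i ∈ B, ∫ ξ, hp ξ * ‖∑ j : Fin N, (Real.exp (-(‖x N j - x N i‖ ^ 2) / L ^ 2) : ℂ) *
            Complex.exp (2 * Real.pi * Complex.I * (inner ℝ ξ (x N j - x N i) : ℂ))‖ ^ 2 := by
          refine Finset.sum_le_sum fun i hi => ?_
          rw [hB, Finset.mem_filter] at hi
          obtain ⟨-, h1, h2⟩ := hi
          have h3 := hIGle i
          nlinarith [hε.le]
      _ ≤ _ := Finset.sum_le_sum_of_subset_of_nonneg (Finset.subset_univ _) fun i _ _ => hIG0 i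
  -- bookkeeping
  have hW : CA * (4 * M * Real.exp (4 * Real.pi * R ^ 2) *
      Real.exp (-(Real.pi ^ 2 * L ^ 2 * d ^ 2 / 8)) * (K * N)) =
      (ε * θ) * (A * Real.exp (-(Real.pi ^ 2 * L ^ 2 * d ^ 2 / 8))) * N := by
    rw [hA]
    field_simp
  have hI1 : CA * ∫ ξ, g₁ ξ * ‖∑ j : Fin N, Complex.exp (2 * Real.pi * Complex.I *
      (inner ℝ ξ (x N j) : ℂ))‖ ^ 2 ≤ (ε * θ) * (ε / 2) * N := by
    have := mul_le_mul_of_nonneg_left hint hCA0.le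
    refine this.trans (le_of_eq ?_)
    field_simp
  have hW2 : (ε * θ) * (A * Real.exp (-(Real.pi ^ 2 * L ^ 2 * d ^ 2 / 8))) * N ≤
      (ε * θ) * (ε / 2) * N := by
    have hεθ : 0 ≤ ε * θ := by positivity
    nlinarith [mul_le_mul_of_nonneg_left hτL.le hεθ, hNr.le]
  have htot : (B.card : ℝ) * (ε * θ * L ^ 3) ≤ (ε * N) * (ε * θ * L ^ 3) := by
    refine hcard.trans (hkey.trans ?_)
    have hL3 : 0 ≤ L ^ 3 := by positivity
    calc K * (Real.pi * Real.sqrt Real.pi) * L ^ 3 *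
          ((∫ ζ, g₁ ζ * ‖∑ j : Fin N, Complex.exp (2 * Real.pi * Complex.I *
            (inner ℝ ζ (x N j) : ℂ))‖ ^ 2) +
            4 * M * Real.exp (4 * Real.pi * R ^ 2) * Real.exp (-(Real.pi ^ 2 * L ^ 2 * d ^ 2 / 8)) *
              (K * N))
        = L ^ 3 * (CA * (∫ ξ, g₁ ξ * ‖∑ j : Fin N, Complex.exp (2 * Real.pi * Complex.I *
            (inner ℝ ξ (x N j) : ℂ))‖ ^ 2) +
            CA * (4 * M * Real.exp (4 * Real.pi * R ^ 2) *
              Real.exp (-(Real.pi ^ 2 * L ^ 2 * d ^ 2 / 8)) * (K * N))) := by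
          rw [hCA]; ring
      _ ≤ L ^ 3 * ((ε * θ) * (ε / 2) * N + (ε * θ) * (ε / 2) * N) := by
          rw [hW]
          exact mul_le_mul_of_nonneg_left (add_le_add hI1 hW2) hL3
      _ = (ε * N) * (ε * θ * L ^ 3) := by ring
  have hpos : 0 < ε * θ * L ^ 3 := by positivity
  exact le_of_mul_le_mul_right htot hpos

end Summit.AtomisticToContinuum.Crystallization.Theorems

end
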